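import Literature.Probability.RandomPlanarGeometry.LoewnerFarField
import HarnessLib

/-!
# [LSW04] eq. (4.11): `g_t(z) = z + 2t/z + O(δ³)` for `t ≤ 2δ²`, `sup |W| ≤ 2δ`

G. F. Lawler, O. Schramm, W. Werner, *Conformal invariance of planar loop-erased random walks and
uniform spanning trees*, Ann. Probab. **32** (2004) 939–995 (**[LSW04]**), proof of Prop. 4.3 (the
key estimate), eq. (4.11) (arXiv:math/0112234, Prop. 22, (e.apx)):

> "Set `V_j := φ_j(v₀)` and `U_j := φ_j ∘ φ₀⁻¹(U)`. By the chordal version of Loewner's equation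
> and the definition of `m`, we have `V_m = V₀ + 2t_m/V₀ + O(δ³)`, `U_m = U₀ + 2t_m/U₀ + O(δ³)`."

Here `φ_j = g_{t_j} ∘ φ₀` with `g_t` the chordal Loewner maps of the capacity-parametrised image
of the Peano path (hydrodynamic normalisation: "`φ_n(z) - φ₀(z) → 0` as `z → b`"), so
`V_m = g_{t_m}(V₀)`, `U_m = g_{t_m}(U₀)`; and by the definition of `m` (the first `n ≥ k` with
`|W_n - W_k| ≥ δ` or `t_n - t_k ≥ δ²`) the time and the driving function are small:
`t_m ≤ δ² + (one step) ≤ 2δ²`, `sup_{[0, t_m]} |W| ≤ δ + (one step) ≤ 2δ`. Proof-only file: the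
statement is the specialisation of the tree's far-field expansion of the chordal Loewner map
(`Loewner.FarRegime.norm_g_sub_expansion_le`, `LoewnerFarField.lean`:
`g_t(z) = z + 2t/z + (2/z²) ∫₀ᵗ W ds + O(α⁴ |z|)`, `α = (K + √t)/|z|`) to driver bound `K = 2δ`,
times `t ≤ 2δ²` and points `1/2 ≤ |z| ≤ 3` (LSW's `V₀ = i + O(δ³)`, `2i + O(δ³)`, `U₀ = 1 + O(δ³)`):
the integral term is `≤ 2Kt/|z|² = O(δ³)` and `α = O(δ)`.

* `Loewner.norm_map_sub_sub_le_of_small` — **(4.11)**: there are absolute `δ₀ > 0`, `C` such that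
  for `0 < δ ≤ δ₀`, every continuous `W` with `|W_s| ≤ 2δ` on `[0, t]`, `t ≤ 2δ²`, and every `z`
  with `1/2 ≤ |z| ≤ 3`: `|g_t(z) - z - 2t/z| ≤ C δ³` (for the tree's `Loewner.map W t`; any
  `z ∈ ℂ`, in particular real `z = U₀`).

## References

* [LSW04] Prop. 4.3, proof, eq. (4.11) [LawlerSchrammWerner2004].
* G. F. Lawler, *Conformally Invariant Processes in the Plane* (2005), §4.1 eq. (4.6), Lemma 4.13
  [Lawler2005].
-/

noncomputable section

open Set Filter Topology Metric MeasureTheory Complex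
open scoped NNReal

namespace Literature.Probability.RandomPlanarGeometry

namespace Loewner

/-- **[LSW04] eq. (4.11): `g_t(z) = z + 2t/z + O(δ³)`.** With the absolute constants `δ₀ = 1/600`
and `C = 700`: for `0 < δ ≤ δ₀`, a continuous driving function with `|W_s| ≤ 2δ` for
`s ∈ [0, t]`, `t ≤ 2δ²`, and `1/2 ≤ |z| ≤ 3`, the chordal Loewner map satisfies
`|g_t(z) - z - 2t/z| ≤ C δ³`. Proof: `z` is in the far-field regime with `K = 2δ`
(`64 (2δ + √t) ≤ 64 · 4δ ≤ 1/2 ≤ |z|`), so by `FarRegime.norm_g_sub_expansion_le`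
`|g_t(z) - z - 2t/z - (2/z²)∫₀ᵗ W| ≤ 32 α⁴ |z|` with `α = (2δ + √t)/|z| ≤ 8δ`, and
`|(2/z²)∫₀ᵗ W| ≤ 2 · (2δ · 2δ²)/|z|² ≤ 32 δ³` (`FarRegime.norm_integral_W_le`).
[cite: LawlerSchrammWerner2004, Prop. 4.3 (proof, eq. (4.11))] -/
theorem norm_map_sub_sub_le_of_small {δ : ℝ} (hδ : 0 < δ) (hδ₀ : δ ≤ 1 / 600) {W : ℝ≥0 → ℝ}
    (hW : Continuous W) {t : ℝ≥0} (ht : (t : ℝ) ≤ 2 * δ ^ 2)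
    (hWb : ∀ u ∈ Icc (0 : ℝ) t, |W u.toNNReal| ≤ 2 * δ) {z : ℂ} (hz1 : 1 / 2 ≤ ‖z‖)
    (hz2 : ‖z‖ ≤ 3) : ‖map W t z - z - 2 * t / z‖ ≤ 700 * δ ^ 3 := by
  -- the far-field regime with `K = 2δ`
  have hsqrt : Real.sqrt t ≤ 2 * δ := by
    rw [Real.sqrt_le_left (by linarith)]
    nlinarith
  have hfar : FarRegime W z t (2 * δ) :=
    { cont := hW
      bound := hWb
      far := by
        have : 64 * (2 * δ + Real.sqrt t) ≤ 64 * (4 * δ) := by gcongr; linarith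
        linarith
      pos := by linarith }
  obtain ⟨g, hg⟩ := hfar.exists_sol
  have hmap : map W t z = g t := by
    have h := hfar.map_eq hg (s := t) ⟨t.coe_nonneg, le_rfl⟩
    rwa [Real.toNNReal_coe] at h
  have hexp := hfar.norm_g_sub_expansion_le hg
  have hint := hfar.norm_integral_W_le
  have hz0 : z ≠ 0 := hfar.z_ne_zero
  -- the expansion parameter `α ≤ 8δ`
  set α : ℝ := (2 * δ + Real.sqrt t) / ‖z‖ with hα
  have hα0 : 0 ≤ α := by positivity
  have hαle : α ≤ 8 * δ := by
    rw [hα, div_le_iff₀ (by linarith)]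
    nlinarith [Real.sqrt_nonneg (t : ℝ)]
  -- the integral term
  have hI : ‖2 / z ^ 2 * ∫ s in (0 : ℝ)..t, (W s.toNNReal : ℂ)‖ ≤ 32 * δ ^ 3 := by
    rw [norm_mul, norm_div, Complex.norm_ofNat, norm_pow]
    have h1 : 2 / ‖z‖ ^ 2 ≤ 8 := by
      rw [div_le_iff₀ (by positivity)]
      nlinarith
    calc 2 / ‖z‖ ^ 2 * ‖∫ s in (0 : ℝ)..t, (W s.toNNReal : ℂ)‖ ≤ 8 * (2 * δ * t) :=
          mul_le_mul h1 hint (norm_nonneg _) (by norm_num)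
      _ ≤ 8 * (2 * δ * (2 * δ ^ 2)) := by gcongr
      _ = 32 * δ ^ 3 := by ring
  -- the fourth-order remainder
  have hR : 32 * α ^ 4 * ‖z‖ ≤ 32 * (8 * δ) ^ 4 * 3 := by
    gcongr
  have hδ4 : δ ^ 4 ≤ δ ^ 3 / 600 := by nlinarith [pow_nonneg hδ.le 3]
  rw [hmap]
  calc ‖g t - z - 2 * t / z‖
      = ‖(g t - z - 2 * t / z - 2 / z ^ 2 * ∫ s in (0 : ℝ)..t, (W s.toNNReal : ℂ)) +
          2 / z ^ 2 * ∫ s in (0 : ℝ)..t, (W s.toNNReal : ℂ)‖ := by rw [sub_add_cancel]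
    _ ≤ 32 * α ^ 4 * ‖z‖ + 32 * δ ^ 3 := (norm_add_le _ _).trans (add_le_add hexp hI)
    _ ≤ 32 * (8 * δ) ^ 4 * 3 + 32 * δ ^ 3 := by linarith
    _ ≤ 700 * δ ^ 3 := by nlinarith

/-- **(4.11) in `∃ δ₀ C` form**, for consumers quantifying over the smallness parameter: there are
`δ₀ > 0` and `C` with `|g_t(z) - z - 2t/z| ≤ C δ³` whenever `0 < δ ≤ δ₀`, `|W| ≤ 2δ` on `[0, t]`,
`t ≤ 2δ²`, `1/2 ≤ |z| ≤ 3`. [cite: LawlerSchrammWerner2004, Prop. 4.3 (proof, eq. (4.11))] -/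
theorem exists_norm_map_sub_sub_le :
    ∃ δ₀ : ℝ, 0 < δ₀ ∧ ∃ C : ℝ, ∀ δ : ℝ, 0 < δ → δ ≤ δ₀ → ∀ (W : ℝ≥0 → ℝ), Continuous W →
      ∀ t : ℝ≥0, (t : ℝ) ≤ 2 * δ ^ 2 → (∀ u ∈ Icc (0 : ℝ) t, |W u.toNNReal| ≤ 2 * δ) →
        ∀ z : ℂ, 1 / 2 ≤ ‖z‖ → ‖z‖ ≤ 3 → ‖map W t z - z - 2 * t / z‖ ≤ C * δ ^ 3 :=
  ⟨1 / 600, by norm_num, 700, fun _ hδ hδ₀ _ hW _ ht hWb _ hz1 hz2 ↦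
    norm_map_sub_sub_le_of_small hδ hδ₀ hW ht hWb hz1 hz2⟩

end Loewner

end Literature.Probability.RandomPlanarGeometry
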